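import Summits.NavierStokesRegularity.NavierStokesRegularity.Theorems.RungBlowupCofinal.BandLimitedCurl
import Summits.NavierStokesRegularity.NavierStokesRegularity.Theorems.RungBlowupCofinal.PureWaveExclusion
import Summits.NavierStokesRegularity.NavierStokesRegularity.Theorems.RungBlowupCofinal.PrecessingLerayReduction
import Summits.NavierStokesRegularity.NavierStokesRegularity.Theorems.RungBlowupCofinal.ConvectiveLiftLetters
import Summits.NavierStokesRegularity.FluidComputer.AngularGalerkinLadderExamples
import Summits.NavierStokesRegularity.FluidComputer.AngularGalerkinLadderLinearFlows
import Summits.NavierStokesRegularity.FluidComputer.AngularGalerkinLadderRadialCutoff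
import Literature.Analysis.FluidPDE.PineauVicolRSSHolds
import Literature.Analysis.FluidPDE.PineauVicolRSSChaeWolf
import HarnessLib

/-!
# BAND-CLOSED NONLINEARITY EXCLUDED: a precessing rung profile whose self-advection stays in the
# band has a GRADIENT defect, is an EXACT rotated Leray profile, and vanishes in the Pineau–Vicol
# window (`|α| ≪ 1` or `|α| ≫ 1`, in particular `α = 0`); PURE-SWIRL profiles are excluded
# (route `AngularGalerkinLadder`, crux K1 `RungBlowupCofinal`; admissibility filter N5, theorems only)

Cell `ns-blowup`, seat `ns-blowup-circuit` (g12, AGL Lean seat). Helper file for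
`stmt-NavierStokesRegularity-19959`, line `Cruxes/RungBlowupCofinal/Lines/qlwave.lean`, in the
series of kernel admissibility filters N1–N4 (`PureWaveExclusion`, `NonlinearityLoadBearing`,
`PrecessingProfileLambLoadBearing`): N3 said the nonlinearity of a rung profile must NOT be
co-band-limited (rung-invisible); this file proves the mirror statement — it must not be
BAND-LIMITED either.

Let `U` be band-limited of degree `≤ L`, `Q` smooth, `E` co-band-limited of degree `L`, and
`−ΔU + ½U + ½DU·y + αJ₃U + (U·∇)U + ∇Q = E` pointwise (the co-precessing truncated backward
Leray system, `J₃ = angGen 2`).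

* **`exact_of_convect_bandLimited`**: if `(U·∇)U` is band-limited of degree `≤ L` then the whole
  residual `G = −ΔU + ½U + ½DU·y + αJ₃U + (U·∇)U` is band-limited (`isBandLimited_profileOp`),
  `G + ∇Q = E` is co-band, hence `curl G = 0` (`curl_eq_zero_of_add_gradient_eq_coband`), hence
  `G = ∇h` (Poincaré, `exists_smooth_gradient_eq`): `U` solves the EXACT rotated Leray system
  `−ΔU + ½U + ½DU·y + αJ₃U + (U·∇)U + ∇P = 0` with `P = −h`, and the defect `E = ∇(h + Q)` is a
  gradient (`defect_eq_gradient_of_convect_bandLimited`).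
* **`eq_zero_of_convect_bandLimited`**: with `div U = 0` and the tail `‖U(y)‖ ≤ C/(‖y‖+1)` the
  physical field `pvAnsatz α U` is a classical Type-I solution of UNFORCED Navier–Stokes on
  `[−1, 0)` (`isClassicalNSSolutionOn_pvAnsatz_forced` with zero force, `norm_pvAnsatz_le_of_profile`),
  so the tree's DISCHARGED Pineau–Vicol theorem (`pineauVicol2026_rss_liouville_holds`,
  Thm. 1.4) gives `α₁, α₂ > 0` depending only on `C` with `U = 0` whenever `|α| < α₁` or
  `|α| > α₂`; **`eq_zero_of_convect_bandLimited_steady`**: `α = 0` needs no window.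
* In the line's letters (`Qlwave.IsPrecessingRungProfile L α C U Q E` unfolded):
  `rungProfile_eq_zero_of_convect_bandLimited`, `rungProfile_eq_zero_of_convect_bandLimited_steady`.
* **PURE SWIRL** `U(y) = Ω(‖y‖²)·e₃ × y` (the zonal toroidal `j = 1` three-lift, no meridional
  circulation): `(U·∇)U = Ω²·e₃ × (e₃ × y)` (`convect_swirl_self`) is a radial multiple of a LINEAR
  field, band-limited of degree `≤ 2` (`isBandLimited_convect_swirl_self`); hence
  **`swirlProfile_eq_zero`**: at every level `L ≥ 2` a pure-swirl precessing rung profile with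
  `|α|` in the Pineau–Vicol window (e.g. `α = 0`, `swirlProfile_eq_zero_steady`) is trivial — a
  first kernel piece of the open pure-ZONAL exclusion (HOME/circuit/agl/PURE-WAVE-EXCLUSION.md §5).

READING for the card: a mean–wave profile must have a nonlinearity with BOTH a non-zero in-band
part (this file) and a non-zero co-band part modulo gradients (N3): the cascade across the cut
`j = L` is load-bearing in both directions. LABEL: KERNEL (conditional on nothing: Pineau–Vicol
Thm. 1.4 and Chae–Wolf are discharged in the tree). WHAT THIS IS NOT: not Navier–Stokes evidence;
no profile is constructed; the window `α₁ ≤ |α| ≤ α₂` (Pineau–Vicol Conjecture 1.1) stays open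
here exactly as in print. References: [cite: PineauVicol2026, Theorem 1.4 and Remark 1.2
(arXiv:2607.09619 p. 4)]; [cite: NecasRuzickaSverak1996, Thm. 1]; [cite: Tsai1998, Thm. 1].
-/

noncomputable section

namespace Summit.NavierStokesRegularity.AngularGalerkinLadderBandClosedNonlinearityExcluded

open Set Function
open scoped ContDiff RealInnerProductSpace Laplacian
open Literature.Analysis.FluidPDE
open Summit.NavierStokesRegularity.FluidComputer Summit.NavierStokesRegularity.FluidComputer.AngularLadder
open Summit.NavierStokesRegularity.AngularGalerkinLadderBandLimitedCurl
open Summit.NavierStokesRegularity.AngularGalerkinLadderPureWaveExclusion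
open Summit.NavierStokesRegularity.AngularGalerkinLadderConvectiveLiftLetters

variable {L : ℕ} {α C : ℝ}
  {U E : EuclideanSpace ℝ (Fin 3) → EuclideanSpace ℝ (Fin 3)} {Q : EuclideanSpace ℝ (Fin 3) → ℝ}

/-! ## §1 A band-closed nonlinearity makes the defect a gradient -/

/-- **Band-closed nonlinearity ⇒ EXACT rotated Leray profile.** If `U` is band-limited of degree
`≤ L`, `E` co-band-limited, `−ΔU + ½U + ½DU·y + αJ₃U + (U·∇)U + ∇Q = E`, and the self-advection
`(U·∇)U` is itself band-limited of degree `≤ L`, then for some smooth `P`,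
`−ΔU + ½U + ½DU·y + αJ₃U + (U·∇)U + ∇P = 0`. [folklore] -/
theorem exact_of_convect_bandLimited (hU : IsBandLimited L U) (hQ : ContDiff ℝ ∞ Q)
    (hE : IsCobandLimited L E)
    (heq : ∀ y, -(Δ U) y + (1 / 2 : ℝ) • U y + (1 / 2 : ℝ) • fderiv ℝ U y y + α • angGen 2 U y +
      convect U U y + gradient Q y = E y)
    (hN : IsBandLimited L (convect U U)) :
    ∃ P : EuclideanSpace ℝ (Fin 3) → ℝ, ContDiff ℝ ∞ P ∧
      ∀ y, -(Δ U) y + (1 / 2 : ℝ) • U y + (1 / 2 : ℝ) • fderiv ℝ U y y + α • angGen 2 U y +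
        convect U U y + gradient P y = 0 := by
  set G : EuclideanSpace ℝ (Fin 3) → EuclideanSpace ℝ (Fin 3) := fun y =>
    (-((1 : ℝ) • (Δ U) y) + (1 / 2 : ℝ) • U y + (1 / 2 : ℝ) • fderiv ℝ U y y + α • angGen 2 U y) +
      convect U U y with hG
  have hGb : IsBandLimited L G := (isBandLimited_profileOp hU 1 α).add hN
  have hGQ : ∀ y, G y + gradient Q y = E y := fun y => by
    simp only [hG, one_smul]; exact heq y
  have hcurl : curl G = 0 := curl_eq_zero_of_add_gradient_eq_coband hGb hQ hE hGQ
  obtain ⟨h, hh, hgrad⟩ := exists_smooth_gradient_eq hGb.1 hcurl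
  refine ⟨fun y => -h y, hh.neg, fun y => ?_⟩
  have hgradneg : gradient (fun z => -h z) y = -G y := by
    rw [← hgrad y]
    show gradient (-h) y = -gradient h y
    simp only [gradient, fderiv_neg, map_neg]
  rw [hgradneg]
  simp only [hG, one_smul]
  abel

/-- **… and the defect is a gradient**: under the same hypotheses `E = ∇φ` for a smooth `φ`
(`φ = h + Q`): a band-closed nonlinearity leaves the rung NOTHING to absorb but pressure.
[folklore] -/
theorem defect_eq_gradient_of_convect_bandLimited (hU : IsBandLimited L U) (hQ : ContDiff ℝ ∞ Q)
    (hE : IsCobandLimited L E)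
    (heq : ∀ y, -(Δ U) y + (1 / 2 : ℝ) • U y + (1 / 2 : ℝ) • fderiv ℝ U y y + α • angGen 2 U y +
      convect U U y + gradient Q y = E y)
    (hN : IsBandLimited L (convect U U)) :
    ∃ φ : EuclideanSpace ℝ (Fin 3) → ℝ, ContDiff ℝ ∞ φ ∧ ∀ y, E y = gradient φ y := by
  obtain ⟨P, hP, hex⟩ := exact_of_convect_bandLimited hU hQ hE heq hN
  refine ⟨fun y => Q y - P y, hQ.sub hP, fun y => ?_⟩
  have hQd : DifferentiableAt ℝ Q y := (hQ.differentiable (by simp)) y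
  have hPd : DifferentiableAt ℝ P y := (hP.differentiable (by simp)) y
  have hgs : gradient (fun z => Q z - P z) y = gradient Q y - gradient P y := by
    show gradient (fun z => Q z - P z) y = gradient Q y - gradient P y
    simp only [gradient, fderiv_fun_sub hQd hPd, map_sub]
  rw [hgs, ← heq y, ← sub_eq_zero]
  have h0 := hex y
  rw [← sub_eq_zero_of_eq h0]
  abel

/-! ## §2 The Liouville theorem: Pineau–Vicol's window, and `α = 0` -/

/-- Rotations fix the origin. [folklore] -/
private theorem rotZ_map_zero (θ : ℝ) : rotZ θ (0 : EuclideanSpace ℝ (Fin 3)) = 0 := by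
  ext i
  fin_cases i <;> simp

/-- **BAND-CLOSED NONLINEARITY EXCLUDED (Pineau–Vicol window).** For every Type-I constant `C`
there are `α₁, α₂ > 0` (Pineau–Vicol's, depending only on `C`) such that: a band-limited
(degree `≤ L`) divergence-free `U` with smooth `Q`, co-band-limited `E`,
`−ΔU + ½U + ½DU·y + αJ₃U + (U·∇)U + ∇Q = E`, tail `‖U(y)‖ ≤ C/(‖y‖+1)`, BAND-LIMITED
self-advection `(U·∇)U`, and precession rate `|α| < α₁` or `|α| > α₂`, vanishes identically.
[cite: PineauVicol2026, Theorem 1.4 (arXiv:2607.09619 p. 4)] -/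
theorem eq_zero_of_convect_bandLimited (C : ℝ) :
    ∃ α₁ α₂ : ℝ, 0 < α₁ ∧ 0 < α₂ ∧
      ∀ (L : ℕ) (α : ℝ) (U E : EuclideanSpace ℝ (Fin 3) → EuclideanSpace ℝ (Fin 3))
        (Q : EuclideanSpace ℝ (Fin 3) → ℝ),
        IsBandLimited L U → VectorCalculus.IsDivFree U → ContDiff ℝ ∞ Q → IsCobandLimited L E →
        (∀ y, -(Δ U) y + (1 / 2 : ℝ) • U y + (1 / 2 : ℝ) • fderiv ℝ U y y + α • angGen 2 U y +
          convect U U y + gradient Q y = E y) →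
        (∀ y, ‖U y‖ ≤ C / (‖y‖ + 1)) → IsBandLimited L (convect U U) →
        (|α| < α₁ ∨ α₂ < |α|) → U = 0 := by
  by_cases hC : 0 < C
  · obtain ⟨α₁, α₂, h1, h2, hPV⟩ := pineauVicol2026_rss_liouville_holds C hC
    refine ⟨α₁, α₂, h1, h2, fun L α U E Q hU hdiv hQ hE heq hdec hN hα => ?_⟩
    obtain ⟨P, hP, hex⟩ := exact_of_convect_bandLimited hU hQ hE heq hN
    have hsys : ∀ z, -((1 : ℝ) • (Δ U) z) + (1 / 2 : ℝ) • U z + (1 / 2 : ℝ) • fderiv ℝ U z z +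
        α • angGen 2 U z + convect U U z + gradient P z =
          (0 : EuclideanSpace ℝ (Fin 3) → EuclideanSpace ℝ (Fin 3)) z := fun z => by
      rw [one_smul, Pi.zero_apply]; exact hex z
    have hcl := AngularGalerkinLadderPrecessingReduction.isClassicalNSSolutionOn_pvAnsatz_forced
      (ν := (1 : ℝ)) (α := α) hU.1 hP hsys hdiv
    simp only [Pi.zero_apply, rotZ_map_zero, smul_zero] at hcl
    have hcl1 : IsClassicalNSSolutionOn (Ico (-1 : ℝ) 0) 1 0 (pvAnsatz α (fun y _ => U y))
        (fun t x => (-t)⁻¹ * P (rotZ (-(α * -Real.log (-t))) ((Real.sqrt (-t))⁻¹ • x))) :=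
      hcl.mono Set.Ico_subset_Iio_self (uniqueDiffOn_Ico (-1 : ℝ) 0)
    have hI : ∀ t ∈ Ico (-1 : ℝ) 0, ∀ x : EuclideanSpace ℝ (Fin 3),
        ‖pvAnsatz α (fun y _ => U y) t x‖ ≤ C / (‖x‖ + Real.sqrt (-t)) :=
      fun t ht x => norm_pvAnsatz_le_of_profile hdec ht.2 x
    have hU2 : ContDiff ℝ 2 U := contDiff_infty.1 hU.1 2
    exact hPV α _ _ U hcl1 hI hU2 (fun t _ x => rfl) hα
  · refine ⟨1, 1, one_pos, one_pos, fun L α U E Q _ _ _ _ _ hdec _ _ => ?_⟩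
    funext y
    have hle : C / (‖y‖ + 1) ≤ 0 := div_nonpos_of_nonpos_of_nonneg (not_lt.1 hC) (by positivity)
    have h0 : ‖U y‖ ≤ 0 := (hdec y).trans hle
    simpa using norm_le_zero_iff.1 h0

/-- **The steady case `α = 0` needs no window**: a band-limited divergence-free Type-I solution of
`−ΔU + ½U + ½DU·y + (U·∇)U + ∇Q = E` (`E` co-band-limited) whose self-advection is band-limited
is trivial. (Equivalently: by §1 it is an exact steady Leray profile with Type-I tail — the
Nečas–Růžička–Šverák / Tsai class.) [cite: PineauVicol2026, Theorem 1.4 (arXiv:2607.09619 p. 4)] -/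
theorem eq_zero_of_convect_bandLimited_steady (hU : IsBandLimited L U)
    (hdiv : VectorCalculus.IsDivFree U) (hQ : ContDiff ℝ ∞ Q) (hE : IsCobandLimited L E)
    (heq : ∀ y, -(Δ U) y + (1 / 2 : ℝ) • U y + (1 / 2 : ℝ) • fderiv ℝ U y y +
      (0 : ℝ) • angGen 2 U y + convect U U y + gradient Q y = E y)
    (hdec : ∀ y, ‖U y‖ ≤ C / (‖y‖ + 1)) (hN : IsBandLimited L (convect U U)) : U = 0 := by
  obtain ⟨α₁, α₂, h1, -, h⟩ := eq_zero_of_convect_bandLimited C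
  exact h L 0 U E Q hU hdiv hQ hE heq hdec hN (Or.inl (by rwa [abs_zero]))

/-! ## §3 In the line's letters (`Qlwave.IsPrecessingRungProfile L α C U Q E` unfolded) -/

/-- **N5 in the letters of `IsPrecessingRungProfile`** (`precResidual α U Q E y = 0` unfolded to
`−ΔU + ½U + ½DU·y + αJ₃U + (U·∇)U + ∇Q − E = 0`): for every `C` there are `α₁, α₂ > 0` such
that a precessing rung profile with band-limited self-advection and `|α| < α₁ ∨ |α| > α₂`
vanishes. (Continuity of `E` is not needed.) [cite: PineauVicol2026, Theorem 1.4 (arXiv:2607.09619 p. 4)] -/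
theorem rungProfile_eq_zero_of_convect_bandLimited (C : ℝ) :
    ∃ α₁ α₂ : ℝ, 0 < α₁ ∧ 0 < α₂ ∧
      ∀ (L : ℕ) (α : ℝ) (U E : EuclideanSpace ℝ (Fin 3) → EuclideanSpace ℝ (Fin 3))
        (Q : EuclideanSpace ℝ (Fin 3) → ℝ),
        IsBandLimited L U → VectorCalculus.IsDivFree U → ContDiff ℝ ∞ Q → IsCobandLimited L E →
        (∀ y, -(Δ U) y + (1 / 2 : ℝ) • U y + (1 / 2 : ℝ) • fderiv ℝ U y y + α • angGen 2 U y +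
          convect U U y + gradient Q y - E y = 0) →
        (∀ y, ‖U y‖ ≤ C / (‖y‖ + 1)) → IsBandLimited L (convect U U) →
        (|α| < α₁ ∨ α₂ < |α|) → ∀ y, U y = 0 := by
  obtain ⟨α₁, α₂, h1, h2, h⟩ := eq_zero_of_convect_bandLimited C
  refine ⟨α₁, α₂, h1, h2, fun L α U E Q hU hdiv hQ hE hres hdec hN hα y => ?_⟩
  have hz := h L α U E Q hU hdiv hQ hE (fun y => sub_eq_zero.1 (hres y)) hdec hN hα
  rw [hz]; rfl

/-- **N5, steady case, in the letters of `IsPrecessingRungProfile L 0 C U Q E`.** [folklore] -/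
theorem rungProfile_eq_zero_of_convect_bandLimited_steady (hU : IsBandLimited L U)
    (hdiv : VectorCalculus.IsDivFree U) (hQ : ContDiff ℝ ∞ Q) (hE : IsCobandLimited L E)
    (hres : ∀ y, -(Δ U) y + (1 / 2 : ℝ) • U y + (1 / 2 : ℝ) • fderiv ℝ U y y +
      (0 : ℝ) • angGen 2 U y + convect U U y + gradient Q y - E y = 0)
    (hdec : ∀ y, ‖U y‖ ≤ C / (‖y‖ + 1)) (hN : IsBandLimited L (convect U U)) : ∀ y, U y = 0 := by
  intro y
  rw [eq_zero_of_convect_bandLimited_steady hU hdiv hQ hE (fun y => sub_eq_zero.1 (hres y))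
    hdec hN]
  rfl

/-! ## §4 PURE SWIRL: the self-advection of `Ω(‖y‖²)·e₃ × y` is band-limited of degree `≤ 2` -/

variable {Ω : ℝ → ℝ}

/-- `e₃ × (c v) = c (e₃ × v)`. [folklore] -/
private theorem cross_axis_smul (c : ℝ) (v : EuclideanSpace ℝ (Fin 3)) :
    cross (axis 2) (c • v) = c • cross (axis 2) v := by
  rw [← crossCLM_apply, map_smul, crossCLM_apply]

/-- **Self-advection of the swirl**: `(U·∇)U(y) = Ω(‖y‖²)²·e₃ × (e₃ × y)` for
`U(y) = Ω(‖y‖²)·e₃ × y` (centripetal: `e₃ × (e₃ × y) = −(y₀, y₁, 0)`). [folklore] -/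
theorem convect_swirl_self (hΩ : Differentiable ℝ Ω) (y : EuclideanSpace ℝ (Fin 3)) :
    convect (fun x : EuclideanSpace ℝ (Fin 3) => Ω (‖x‖ ^ 2) • cross (axis 2) x)
        (fun x : EuclideanSpace ℝ (Fin 3) => Ω (‖x‖ ^ 2) • cross (axis 2) x) y =
      (Ω (‖y‖ ^ 2)) ^ 2 • cross (axis 2) (cross (axis 2) y) := by
  have h := swirl_wave_coupling hΩ
    (fun x : EuclideanSpace ℝ (Fin 3) => Ω (‖x‖ ^ 2) • cross (axis 2) x) y
  simp only [angGen_two_swirl hΩ, inner_self_swirl, sub_zero, mul_zero, zero_smul, add_zero,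
    cross_axis_smul, smul_smul] at h
  have h2 : (2 : ℝ) • convect (fun x : EuclideanSpace ℝ (Fin 3) => Ω (‖x‖ ^ 2) • cross (axis 2) x)
      (fun x : EuclideanSpace ℝ (Fin 3) => Ω (‖x‖ ^ 2) • cross (axis 2) x) y =
      (2 : ℝ) • ((Ω (‖y‖ ^ 2)) ^ 2 • cross (axis 2) (cross (axis 2) y)) := by
    rw [two_smul, h, smul_smul]
    congr 1
    ring
  exact smul_right_injective _ (two_ne_zero) h2

/-- **The swirl's self-advection is band-limited of every degree `L ≥ 2`**: it is the radial
multiple `Ω(‖y‖²)²` of the LINEAR field `y ↦ e₃ × (e₃ × y)` (`isBandLimited_two_clm`,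
`IsBandLimited.radial_smul`). [folklore] -/
theorem isBandLimited_convect_swirl_self (hΩ : ContDiff ℝ ∞ Ω) (hL : 2 ≤ L) :
    IsBandLimited L (convect (fun x : EuclideanSpace ℝ (Fin 3) => Ω (‖x‖ ^ 2) • cross (axis 2) x)
      (fun x : EuclideanSpace ℝ (Fin 3) => Ω (‖x‖ ^ 2) • cross (axis 2) x)) := by
  have key : IsBandLimited 2 fun x : EuclideanSpace ℝ (Fin 3) =>
      (fun r => Ω r ^ 2) (‖x‖ ^ 2) • ((crossCLM (axis 2)).comp (crossCLM (axis 2))) x :=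
    (isBandLimited_two_clm ((crossCLM (axis 2)).comp (crossCLM (axis 2)))).radial_smul (hΩ.pow 2)
  have e : convect (fun x : EuclideanSpace ℝ (Fin 3) => Ω (‖x‖ ^ 2) • cross (axis 2) x)
      (fun x : EuclideanSpace ℝ (Fin 3) => Ω (‖x‖ ^ 2) • cross (axis 2) x) =
      fun x : EuclideanSpace ℝ (Fin 3) =>
        (fun r => Ω r ^ 2) (‖x‖ ^ 2) • ((crossCLM (axis 2)).comp (crossCLM (axis 2))) x := by
    funext y
    rw [convect_swirl_self (hΩ.differentiable (by simp)) y]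
    simp only [ContinuousLinearMap.coe_comp, Function.comp_apply, crossCLM_apply]
  rw [e]
  exact key.mono hL

/-- **PURE-SWIRL PROFILES EXCLUDED (Pineau–Vicol window).** For every `C` there are
`α₁, α₂ > 0` such that at every level `L ≥ 2`: if the pure swirl `U(y) = Ω(‖y‖²)·e₃ × y`
(`Ω` smooth) solves `−ΔU + ½U + ½DU·y + αJ₃U + (U·∇)U + ∇Q = E` with `Q` smooth, `E`
co-band-limited of degree `L`, tail `‖U(y)‖ ≤ C/(‖y‖+1)` and `|α| < α₁ ∨ |α| > α₂`, then `U = 0`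
(the swirl is band-limited of degree `1 ≤ L` and divergence-free for free:
`isBandLimited_radial_cross`, `isDivFree_radial_cross`). [cite: PineauVicol2026, Theorem 1.4 (arXiv:2607.09619 p. 4)] -/
theorem swirlProfile_eq_zero (C : ℝ) :
    ∃ α₁ α₂ : ℝ, 0 < α₁ ∧ 0 < α₂ ∧
      ∀ (L : ℕ) (α : ℝ) (Ω : ℝ → ℝ) (E : EuclideanSpace ℝ (Fin 3) → EuclideanSpace ℝ (Fin 3))
        (Q : EuclideanSpace ℝ (Fin 3) → ℝ), 2 ≤ L → ContDiff ℝ ∞ Ω → ContDiff ℝ ∞ Q →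
        IsCobandLimited L E →
        (∀ y, -(Δ (fun x : EuclideanSpace ℝ (Fin 3) => Ω (‖x‖ ^ 2) • cross (axis 2) x)) y +
          (1 / 2 : ℝ) • (Ω (‖y‖ ^ 2) • cross (axis 2) y) +
          (1 / 2 : ℝ) • fderiv ℝ (fun x : EuclideanSpace ℝ (Fin 3) => Ω (‖x‖ ^ 2) • cross (axis 2) x) y y +
          α • angGen 2 (fun x : EuclideanSpace ℝ (Fin 3) => Ω (‖x‖ ^ 2) • cross (axis 2) x) y +
          convect (fun x : EuclideanSpace ℝ (Fin 3) => Ω (‖x‖ ^ 2) • cross (axis 2) x)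
            (fun x : EuclideanSpace ℝ (Fin 3) => Ω (‖x‖ ^ 2) • cross (axis 2) x) y +
          gradient Q y = E y) →
        (∀ y, ‖Ω (‖y‖ ^ 2) • cross (axis 2) y‖ ≤ C / (‖y‖ + 1)) →
        (|α| < α₁ ∨ α₂ < |α|) →
        (fun x : EuclideanSpace ℝ (Fin 3) => Ω (‖x‖ ^ 2) • cross (axis 2) x) = 0 := by
  obtain ⟨α₁, α₂, h1, h2, h⟩ := eq_zero_of_convect_bandLimited C
  refine ⟨α₁, α₂, h1, h2, fun L α Ω E Q hL hΩ hQ hE heq hdec hα => ?_⟩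
  exact h L α _ E Q (isBandLimited_radial_cross hΩ (axis 2) (le_trans (by norm_num) hL))
    (isDivFree_radial_cross (hΩ.differentiable (by simp)) (axis 2)) hQ hE heq hdec
    (isBandLimited_convect_swirl_self hΩ hL) hα

/-- **Pure-swirl profiles excluded, steady case (`α = 0`, no window).** [folklore] -/
theorem swirlProfile_eq_zero_steady (hL : 2 ≤ L) (hΩ : ContDiff ℝ ∞ Ω) (hQ : ContDiff ℝ ∞ Q)
    (hE : IsCobandLimited L E)
    (heq : ∀ y, -(Δ (fun x : EuclideanSpace ℝ (Fin 3) => Ω (‖x‖ ^ 2) • cross (axis 2) x)) y +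
      (1 / 2 : ℝ) • (Ω (‖y‖ ^ 2) • cross (axis 2) y) +
      (1 / 2 : ℝ) • fderiv ℝ (fun x : EuclideanSpace ℝ (Fin 3) => Ω (‖x‖ ^ 2) • cross (axis 2) x) y y +
      (0 : ℝ) • angGen 2 (fun x : EuclideanSpace ℝ (Fin 3) => Ω (‖x‖ ^ 2) • cross (axis 2) x) y +
      convect (fun x : EuclideanSpace ℝ (Fin 3) => Ω (‖x‖ ^ 2) • cross (axis 2) x)
        (fun x : EuclideanSpace ℝ (Fin 3) => Ω (‖x‖ ^ 2) • cross (axis 2) x) y +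
      gradient Q y = E y)
    (hdec : ∀ y, ‖Ω (‖y‖ ^ 2) • cross (axis 2) y‖ ≤ C / (‖y‖ + 1)) :
    ∀ y : EuclideanSpace ℝ (Fin 3), Ω (‖y‖ ^ 2) • cross (axis 2) y = 0 := by
  obtain ⟨α₁, α₂, h1, -, h⟩ := swirlProfile_eq_zero C
  have hz := h L 0 Ω E Q hL hΩ hQ hE heq hdec (Or.inl (by rwa [abs_zero]))
  intro y
  have := congrFun hz y
  simpa using this

end Summit.NavierStokesRegularity.AngularGalerkinLadderBandClosedNonlinearityExcluded

end
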